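import Mathlib.Geometry.Manifold.ContMDiffMFDeriv
import Mathlib.Geometry.Manifold.VectorBundle.Hom
import Mathlib.Geometry.Manifold.ContMDiff.NormedSpace
import Literature.Geometry.Lorentzian.Isometry
import HarnessLib

/-!
# Smoothness of pulled-back bilinear forms: discharge of `contMDiff_pullbackBilin`

Companion ("Proofs") file of `Literature/Geometry/Lorentzian/Isometry.lean`. That file vendors,
as the named fact `PseudoRiemannianMetric.contMDiff_pullbackBilin I M I' N n`, the smoothness of
the pullback of a metric: if `g` is a `C^n` pseudo-Riemannian metric on `TM` (a `C^n` section of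
the bundle of bilinear forms) and `f : N → M` is `C^{n+1}`, then `f^* g`
(`pullbackBilin f g.val`, `(f^* g)_y (v, w) = g_{f y} (df_y v, df_y w)`) is a `C^n` section of the
bundle of bilinear forms on `TN` (O'Neill 1983, Ch. 3, Def. 3.9, Lemma 3.35 ff.: in charts
`f^* g = (Df)ᵀ (g ∘ f) (Df)`). It is the hypothesis `hpb` threaded through
`PseudoRiemannianMetric.comap`, `LorentzianMetric.comap`, `TimeOrientation.comap`
(`Isometry.lean`), the induced metrics of `Hypersurface.lean`, `BondiMass.lean`, … This file
PROVES it: `PseudoRiemannianMetric.contMDiff_pullbackBilin_holds`, for every regularity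
`n : ℕ∞ω` and arbitrary (possibly infinite-dimensional, possibly with boundary) real models.

## Proof

Everything is read in the canonical trivializations of the bundles involved, with Mathlib's
`inCoordinates` / `inTangentCoordinates` machinery:

* `trivializationAt_bilin_snd`, `contMDiffAt_bilin_iff` — for any real vector bundle `V` with
  fibre `F`, the trivialization at `b₀` of the bundle of bilinear forms `Hom(V, Hom(V, ℝ))`
  (Mathlib's iterated `Bundle.ContinuousLinearMap` with the trivial bundle `ℝ`) sends a form
  `φ` on `V b` to `(e, e') ↦ φ (τ⁻¹ e) (τ⁻¹ e')`, `τ` the trivialization of `V` at `b₀`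
  (`hom_trivializationAt_apply` twice and `Bundle.Trivial.continuousLinearMapAt_trivialization`);
  hence a map `x ↦ (b x, s x)` into that bundle is `C^k` at `x₀` iff `b` is and the coordinate
  expression `x ↦ precomp τ⁻¹ ∘ s x ∘ τ⁻¹` is `C^k` into the normed space `F →L F →L ℝ`
  (`contMDiffAt_totalSpace`).
* For the pullback: with `Φ y = τ_M ∘ df_y ∘ τ_N⁻¹` (`inTangentCoordinates I' I id f (mfderiv f) y₀`,
  `C^n` at `y₀` by `ContMDiffAt.mfderiv_const` since `f` is `C^{n+1}`) and `β x` the coordinate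
  expression of `g` at `f y₀` (`C^n` by the criterion applied to `g.contMDiff`), the coordinate
  expression of `f^* g` near `y₀` is `precomp (Φ y) ∘ β (f y) ∘ Φ y`
  (`Trivialization.symmL_continuousLinearMapAt`), which is `C^n` by `ContMDiffAt.clm_precomp`,
  `ContMDiffAt.clm_comp` and `ContMDiffAt.comp`.

## Pulled-back time orientations: discharge of `TimeOrientation.contMDiff_comapFun`

`Isometry.lean` also vendors, as the named fact `τ.contMDiff_comapFun I' N`, the smoothness of the
vector field `f^* T : y ↦ (df_y)⁻¹ (T (f y))` underlying the pulled-back time orientation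
`TimeOrientation.comap` along a `C^{n+1}` immersion `f : N → M` between (finite-dimensional)
manifolds of the same dimension, i.e. a local diffeomorphism (O'Neill 1983, Ch. 1, Thm. 1.16 and
pp. 20–21; Ch. 3, p. 90; Ch. 7, p. 191 for pulled-back orientations). This file PROVES it,
`TimeOrientation.contMDiff_comapFun_holds`, again in the canonical trivializations and without
the inverse function theorem: with `A y = τ_M ∘ df_y ∘ τ_N⁻¹` the differential read in charts
(`C^n` at `y₀` by `ContMDiffAt.mfderiv_const`), the fibrewise inverse `(df_y)⁻¹` read in charts
is the two-sided inverse `(A y)⁻¹` over the common chart domain; `A y₀` is invertible, inversion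
of continuous linear maps is smooth at invertible maps
(`ContinuousLinearMap.IsInvertible.contDiffAt_map_inverse`, `E'` being complete as it is
finite-dimensional), so `y ↦ (A y)⁻¹` is `C^n` at `y₀`, and
`ContMDiffAt.clm_apply_of_inCoordinates` applied to the `C^n` section `T ∘ f` along `f` gives
that `y ↦ (df_y)⁻¹ (T (f y))` is a `C^n` section of `TN` at `y₀`.

## References

* B. O'Neill, *Semi-Riemannian geometry with applications to relativity*, Academic Press 1983,
  Ch. 1, Thm. 1.16 (inverse function theorem, local diffeomorphisms), Ch. 3, Def. 3.9 (pullback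
  of covariant tensors) and Lemma 3.35 ff., Def. 3.60 and p. 90 (local isometries), Ch. 7,
  p. 191 (pulled-back orientations). [ONeill1983]
-/

open Bundle Set Function
open scoped Manifold ContDiff Topology

noncomputable section

namespace Literature.Geometry.Lorentzian

/-! ### Bilinear forms on a vector bundle read in a trivialization -/

section BilinCoord

variable {B : Type*} [TopologicalSpace B] {F : Type*} [NormedAddCommGroup F] [NormedSpace ℝ F]
  {V : B → Type*} [TopologicalSpace (TotalSpace F V)] [∀ b, TopologicalSpace (V b)]
  [∀ b, AddCommGroup (V b)] [∀ b, Module ℝ (V b)] [FiberBundle F V] [VectorBundle ℝ F V]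

/-- **The bundle of bilinear forms read in its canonical trivialization.** For a real vector
bundle `V` with fibre `F` and the bundle `Hom(V, Hom(V, ℝ))` of continuous bilinear forms on its
fibres (iterated `Bundle.ContinuousLinearMap`, target the trivial bundle `ℝ`): over the base set
of the trivialization `τ` of `V` at `b₀`, the fibre coordinate at `b₀` of a form `φ` on `V b` is
`(e, e') ↦ φ (τ_b⁻¹ e) (τ_b⁻¹ e')`, i.e. `precomp τ_b⁻¹ ∘ φ ∘ τ_b⁻¹` (Mathlib
`hom_trivializationAt_apply`, twice). [folklore] -/
theorem trivializationAt_bilin_snd (b₀ : B) {b : B}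
    (hb : b ∈ (trivializationAt F V b₀).baseSet) (φ : V b →L[ℝ] V b →L[ℝ] ℝ) :
    (trivializationAt (F →L[ℝ] F →L[ℝ] ℝ) (fun b ↦ V b →L[ℝ] V b →L[ℝ] ℝ) b₀ ⟨b, φ⟩).2 =
      (ContinuousLinearMap.precomp ℝ ((trivializationAt F V b₀).symmL ℝ b)).comp
        (φ.comp ((trivializationAt F V b₀).symmL ℝ b)) := by
  rw [hom_trivializationAt_apply]
  simp only [ContinuousLinearMap.inCoordinates]
  congr 1
  ext ψ e
  have hb' : b ∈ (trivializationAt (F →L[ℝ] ℝ) (fun b ↦ V b →L[ℝ] ℝ) b₀).baseSet := by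
    rw [hom_trivializationAt_baseSet]
    exact ⟨hb, mem_univ _⟩
  rw [Trivialization.continuousLinearMapAt_apply_of_mem ℝ _ hb', hom_trivializationAt_apply]
  simp only [ContinuousLinearMap.inCoordinates, ContinuousLinearMap.coe_comp, comp_apply,
    ContinuousLinearMap.precomp_apply]
  exact congrFun (congrArg DFunLike.coe
    (Bundle.Trivial.continuousLinearMapAt_trivialization (𝕜 := ℝ) (B := B) (F := ℝ) b)) _

variable {EX : Type*} [NormedAddCommGroup EX] [NormedSpace ℝ EX] {HX : Type*} [TopologicalSpace HX]
  {IX : ModelWithCorners ℝ EX HX} {X : Type*} [TopologicalSpace X] [ChartedSpace HX X]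
  {EB : Type*} [NormedAddCommGroup EB] [NormedSpace ℝ EB] {HB : Type*} [TopologicalSpace HB]
  {IB : ModelWithCorners ℝ EB HB} [ChartedSpace HB B] {k : ℕ∞ω}

/-- **Smoothness criterion for bilinear-form-valued maps into `Hom(V, Hom(V, ℝ))`.** A map
`x ↦ (b x, s x)` into the bundle of bilinear forms on `V` is `C^k` at `x₀` iff the base map `b`
is `C^k` at `x₀` and the coordinate expression
`x ↦ ((e, e') ↦ s x (τ⁻¹_{b x} e) (τ⁻¹_{b x} e'))`, `τ` the trivialization of `V` at `b x₀`, is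
`C^k` at `x₀` as a map into the normed space `F →L F →L ℝ`. [folklore] -/
theorem contMDiffAt_bilin_iff {b : X → B} {s : ∀ x, V (b x) →L[ℝ] V (b x) →L[ℝ] ℝ} {x₀ : X} :
    ContMDiffAt IX (IB.prod 𝓘(ℝ, F →L[ℝ] F →L[ℝ] ℝ)) k
        (fun x ↦ TotalSpace.mk' (F →L[ℝ] F →L[ℝ] ℝ) (E := fun b ↦ V b →L[ℝ] V b →L[ℝ] ℝ)
          (b x) (s x)) x₀ ↔
      ContMDiffAt IX IB k b x₀ ∧
        ContMDiffAt IX 𝓘(ℝ, F →L[ℝ] F →L[ℝ] ℝ) k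
          (fun x ↦ (ContinuousLinearMap.precomp ℝ ((trivializationAt F V (b x₀)).symmL ℝ (b x))).comp
            ((s x).comp ((trivializationAt F V (b x₀)).symmL ℝ (b x)))) x₀ := by
  rw [contMDiffAt_totalSpace]
  refine and_congr_right fun hb ↦ ?_
  dsimp only [TotalSpace.mk']
  have hev : ∀ᶠ x in 𝓝 x₀, b x ∈ (trivializationAt F V (b x₀)).baseSet :=
    hb.continuousAt.preimage_mem_nhds
      ((trivializationAt F V (b x₀)).open_baseSet.mem_nhds
        (FiberBundle.mem_baseSet_trivializationAt' (b x₀)))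
  refine Filter.EventuallyEq.contMDiffAt_iff (hev.mono fun x hx ↦ ?_)
  exact trivializationAt_bilin_snd (b x₀) hx (s x)

end BilinCoord

/-! ### The pullback of a smooth bilinear form along a smooth map is smooth -/

variable {E : Type*} [NormedAddCommGroup E] [NormedSpace ℝ E] {H : Type*} [TopologicalSpace H]
  {I : ModelWithCorners ℝ E H} {M : Type*} [TopologicalSpace M] [ChartedSpace H M]
  {E' : Type*} [NormedAddCommGroup E'] [NormedSpace ℝ E'] {H' : Type*} [TopologicalSpace H']
  {I' : ModelWithCorners ℝ E' H'} {N : Type*} [TopologicalSpace N] [ChartedSpace H' N]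
  {n : ℕ∞ω}

namespace PseudoRiemannianMetric

/-- **DISCHARGE of `contMDiff_pullbackBilin`.** The pullback `f^* g` of a `C^n` section `g` of
the bundle of bilinear forms on `TM` along a `C^{n+1}` map `f : N → M` is a `C^n` section of the
bundle of bilinear forms on `TN`. In tangent coordinates around `y₀` and `f y₀`,
`f^* g = (Φ)ᵀ (β ∘ f) Φ` where `Φ y = D(f)` read in charts (`inTangentCoordinates`, `C^n` by
`ContMDiffAt.mfderiv_const`) and `β` is `g` read in charts (`C^n` by the smoothness criterion for
bilinear-form-valued maps, `contMDiffAt_bilin_iff`); the composite is `C^n` by the calculus of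
continuous-linear-map-valued functions. O'Neill 1983, Ch. 3, Def. 3.9 and Lemma 3.35 ff.
[cite: ONeill1983, Ch. 3, Def. 3.9 and Lemma 3.35] -/
theorem contMDiff_pullbackBilin_holds : contMDiff_pullbackBilin I M I' N n := by
  intro _ _ f hf g y₀
  rw [contMDiffAt_bilin_iff]
  refine ⟨contMDiffAt_id, ?_⟩
  -- notation: `τN`, `τM` the trivializations of `TN` at `y₀` and of `TM` at `f y₀`
  set τN := trivializationAt E' (TangentSpace I' : N → Type _) y₀ with hτN
  set τM := trivializationAt E (TangentSpace I : M → Type _) (f y₀) with hτM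
  -- `Φ y = τM ∘ Df_y ∘ τN⁻¹` (the derivative read in charts), `C^n` at `y₀`
  set Φ : N → E' →L[ℝ] E := inTangentCoordinates I' I id f (fun y ↦ mfderiv I' I f y) y₀ with hΦ
  have hΦs : ContMDiffAt I' 𝓘(ℝ, E' →L[ℝ] E) n Φ y₀ :=
    ContMDiffAt.mfderiv_const (hf y₀) le_rfl
  -- `β x = τM⁻ᵀ g_x τM⁻¹` (the metric read in the chart at `f y₀`), `C^n` at `f y₀`
  set β : M → E →L[ℝ] E →L[ℝ] ℝ := fun x ↦
    (ContinuousLinearMap.precomp ℝ (τM.symmL ℝ x)).comp ((g.val x).comp (τM.symmL ℝ x)) with hβ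
  have hβs : ContMDiffAt I 𝓘(ℝ, E →L[ℝ] E →L[ℝ] ℝ) n β (f y₀) :=
    ((contMDiffAt_bilin_iff (IX := I) (IB := I) (V := (TangentSpace I : M → Type _)) (b := id)
      (s := g.val) (x₀ := f y₀)).1 (g.contMDiff (f y₀))).2
  have hf' : ContMDiffAt I' I n f y₀ := (hf y₀).of_le le_self_add
  have hβf : ContMDiffAt I' 𝓘(ℝ, E →L[ℝ] E →L[ℝ] ℝ) n (fun y ↦ β (f y)) y₀ :=
    ContMDiffAt.comp y₀ hβs hf'
  -- the composite `y ↦ Φᵀ (β (f y)) Φ` is `C^n` at `y₀`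
  have h1 : ContMDiffAt I' 𝓘(ℝ, E' →L[ℝ] E →L[ℝ] ℝ) n (fun y ↦ (β (f y)).comp (Φ y)) y₀ :=
    ContMDiffAt.clm_comp hβf hΦs
  have h2 : ContMDiffAt I' 𝓘(ℝ, (E →L[ℝ] ℝ) →L[ℝ] (E' →L[ℝ] ℝ)) n
      (fun y ↦ (Φ y).precomp ℝ) y₀ :=
    hΦs.clm_precomp (F₃ := ℝ)
  have hcomp : ContMDiffAt I' 𝓘(ℝ, E' →L[ℝ] E' →L[ℝ] ℝ) n
      (fun y ↦ ((Φ y).precomp ℝ).comp ((β (f y)).comp (Φ y))) y₀ :=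
    ContMDiffAt.clm_comp h2 h1
  -- and it agrees with the coordinate expression of `f^* g` near `y₀`
  refine hcomp.congr_of_eventuallyEq ?_
  have hev : ∀ᶠ y in 𝓝 y₀, f y ∈ τM.baseSet :=
    (hf y₀).continuousAt.preimage_mem_nhds
      (τM.open_baseSet.mem_nhds (FiberBundle.mem_baseSet_trivializationAt' (f y₀)))
  filter_upwards [hev] with y hfy
  ext e e'
  have key : ∀ v : E', τM.symmL ℝ (f y) (Φ y v) = mfderiv I' I f y (τN.symmL ℝ y v) := by
    intro v
    simp only [hΦ, inTangentCoordinates, ContinuousLinearMap.inCoordinates,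
      ContinuousLinearMap.coe_comp, comp_apply, id_eq]
    exact τM.symmL_continuousLinearMapAt hfy _
  simp only [ContinuousLinearMap.coe_comp, comp_apply, ContinuousLinearMap.precomp_apply,
    pullbackBilin_apply, hβ, key]
  rfl

end PseudoRiemannianMetric

/-! ### The pulled-back time-orienting vector field along a local diffeomorphism is smooth -/

namespace TimeOrientation

variable [IsManifold I ∞ M] {g : LorentzianMetric I n M} (τ : TimeOrientation g)

/-- **DISCHARGE of `TimeOrientation.contMDiff_comapFun`.** If `T` is a `C^n` vector field on `M`
(the orienting field of a time orientation `τ`) and `f : N → M` is a `C^{n+1}` immersion between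
finite-dimensional manifolds whose models have the same dimension (so every `df_y` is a linear
isomorphism and `f` is a local diffeomorphism), then the pulled-back field
`f^* T : y ↦ (df_y)⁻¹ (T (f y))` (`TimeOrientation.comapFun`) is a `C^n` section of `TN`.
Proof in the canonical trivializations `τ_N` of `TN` at `y₀` and `τ_M` of `TM` at `f y₀`: the
differential read in charts, `A y = τ_M ∘ df_y ∘ τ_N⁻¹` (`inTangentCoordinates`), is `C^n` at `y₀`
(`ContMDiffAt.mfderiv_const`); the fibrewise inverse read in charts,
`B y = τ_N ∘ (df_y)⁻¹ ∘ τ_M⁻¹` (`ContinuousLinearMap.inCoordinates`), is the two-sided inverse of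
`A y` over the common chart domain, hence `B = A⁻¹` near `y₀` is `C^n` at `y₀` (inversion is
smooth at the invertible map `A y₀`, `ContinuousLinearMap.IsInvertible.contDiffAt_map_inverse`);
finally `ContMDiffAt.clm_apply_of_inCoordinates` applies `(df_y)⁻¹` to the `C^n` section `T ∘ f`
along `f`. O'Neill 1983, Ch. 1, Thm. 1.16 and pp. 20–21 (local diffeomorphisms), Ch. 3, p. 90,
Ch. 7, p. 191 (structures pulled back along local diffeomorphisms).
[cite: ONeill1983, Ch. 1, Thm. 1.16 and pp. 20–21; Ch. 3, p. 90] -/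
theorem contMDiff_comapFun_holds : τ.contMDiff_comapFun I' N := by
  intro _ _ _ f hf hf' hdim y₀
  -- the fibrewise inverse `ϕ y = (df_y)⁻¹ : T_{f y} M →L T_y N` (continuous: finite dimension)
  have _iT2 : ∀ x : M, T2Space (TangentSpace I x) := fun _ ↦ inferInstanceAs (T2Space E)
  have _iFD : ∀ x : M, FiniteDimensional ℝ (TangentSpace I x) := fun _ ↦
    inferInstanceAs (FiniteDimensional ℝ E)
  set ϕ : Π y : N, TangentSpace I (f y) →L[ℝ] TangentSpace I' y := fun y ↦
    LinearMap.toContinuousLinearMap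
      (mfderivEquivOfInjective (I := I) (I' := I') f y (hf' y) hdim).symm.toLinearMap with hϕ_def
  have hϕl : ∀ y (u : TangentSpace I' y), ϕ y (mfderiv I' I f y u) = u := fun y u ↦ by
    simp only [hϕ_def, LinearMap.coe_toContinuousLinearMap', LinearEquiv.coe_coe]
    exact (LinearEquiv.symm_apply_eq _).2
      (mfderivEquivOfInjective_apply (I := I) (I' := I') f y (hf' y) hdim u).symm
  have hϕr : ∀ y (w : TangentSpace I (f y)), mfderiv I' I f y (ϕ y w) = w := fun y w ↦ by
    simp only [hϕ_def, LinearMap.coe_toContinuousLinearMap', LinearEquiv.coe_coe]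
    exact mfderiv_mfderivEquivOfInjective_symm f y (hf' y) hdim w
  -- the section `T ∘ f` of `TM` along `f` is `C^n` at `y₀`
  have hv : ContMDiffAt I' (I.prod 𝓘(ℝ, E)) n
      (fun y ↦ (TotalSpace.mk' E (f y) (τ.vectorField (f y)) : TangentBundle I M)) y₀ :=
    (τ.contMDiff (f y₀)).comp y₀ ((hf y₀).of_le le_self_add)
  -- `A y = τM ∘ df_y ∘ τN⁻¹`: the differential read in the trivializations `τN` of `TN` at `y₀`
  -- and `τM` of `TM` at `f y₀`; `C^n` at `y₀` since `f` is `C^{n+1}`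
  set A : N → E' →L[ℝ] E := inTangentCoordinates I' I id f (fun y ↦ mfderiv I' I f y) y₀ with hA
  have hAs : ContMDiffAt I' 𝓘(ℝ, E' →L[ℝ] E) n A y₀ := ContMDiffAt.mfderiv_const (hf y₀) le_rfl
  -- `B y = τN ∘ (df_y)⁻¹ ∘ τM⁻¹`: the fibrewise inverse read in the same trivializations
  set B : N → E →L[ℝ] E' := fun y ↦ ContinuousLinearMap.inCoordinates E
    (TangentSpace I : M → Type _) E' (TangentSpace I' : N → Type _) (f y₀) (f y) y₀ y (ϕ y) with hB
  -- over the common chart domain `B y` is the two-sided inverse of `A y`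
  have hinvAB : ∀ y, y ∈ (trivializationAt E' (TangentSpace I' : N → Type _) y₀).baseSet →
      f y ∈ (trivializationAt E (TangentSpace I : M → Type _) (f y₀)).baseSet →
      (A y).comp (B y) = ContinuousLinearMap.id ℝ E ∧
        (B y).comp (A y) = ContinuousLinearMap.id ℝ E' := by
    intro y hy hfy
    constructor
    · ext w
      simp only [hA, hB, inTangentCoordinates, ContinuousLinearMap.inCoordinates,
        ContinuousLinearMap.coe_comp, comp_apply, id_eq, ContinuousLinearMap.coe_id']
      rw [Trivialization.symmL_continuousLinearMapAt (R := ℝ) _ hy, hϕr,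
        Trivialization.continuousLinearMapAt_symmL (R := ℝ) _ hfy]
    · ext v
      simp only [hA, hB, inTangentCoordinates, ContinuousLinearMap.inCoordinates,
        ContinuousLinearMap.coe_comp, comp_apply, id_eq, ContinuousLinearMap.coe_id']
      rw [Trivialization.symmL_continuousLinearMapAt (R := ℝ) _ hfy, hϕl,
        Trivialization.continuousLinearMapAt_symmL (R := ℝ) _ hy]
  have hy₀ : y₀ ∈ (trivializationAt E' (TangentSpace I' : N → Type _) y₀).baseSet :=
    FiberBundle.mem_baseSet_trivializationAt' y₀
  have hfy₀ : f y₀ ∈ (trivializationAt E (TangentSpace I : M → Type _) (f y₀)).baseSet :=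
    FiberBundle.mem_baseSet_trivializationAt' (f y₀)
  -- `A y₀` is invertible, so inversion is smooth at `A y₀` and `y ↦ (A y)⁻¹` is `C^n` at `y₀`
  have hA₀ : (A y₀).IsInvertible :=
    ContinuousLinearMap.IsInvertible.of_inverse (hinvAB y₀ hy₀ hfy₀).1 (hinvAB y₀ hy₀ hfy₀).2
  haveI : CompleteSpace E' := FiniteDimensional.complete ℝ E'
  have hAinv : ContMDiffAt I' 𝓘(ℝ, E →L[ℝ] E') n (fun y ↦ (A y).inverse) y₀ :=
    hA₀.contDiffAt_map_inverse.comp_contMDiffAt hAs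
  -- hence `B = A⁻¹` (near `y₀`) is `C^n` at `y₀`
  have hBs : ContMDiffAt I' 𝓘(ℝ, E →L[ℝ] E') n B y₀ := by
    refine hAinv.congr_of_eventuallyEq ?_
    filter_upwards [(trivializationAt E' (TangentSpace I' : N → Type _) y₀).open_baseSet.mem_nhds
      hy₀, (hf y₀).continuousAt.preimage_mem_nhds
        ((trivializationAt E (TangentSpace I : M → Type _) (f y₀)).open_baseSet.mem_nhds hfy₀)]
      with y hy hfy
    exact (ContinuousLinearMap.inverse_eq (hinvAB y hy hfy).1 (hinvAB y hy hfy).2).symm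
  -- conclude: `y ↦ ϕ y (T (f y)) = (f^* T) y` is a `C^n` section of `TN`
  have key := ContMDiffAt.clm_apply_of_inCoordinates (IB₂ := I') (F₂ := E')
    (E₂ := (TangentSpace I' : N → Type _)) (b₁ := f) (b₂ := id) (ϕ := ϕ)
    (v := fun y ↦ τ.vectorField (f y)) hBs hv contMDiffAt_id
  refine key.congr_of_eventuallyEq (Filter.Eventually.of_forall fun y ↦ ?_)
  simp only [hϕ_def, id_eq]
  rfl

end TimeOrientation

end Literature.Geometry.Lorentzian

end
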